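import Literature.Computability.Complexity.StackModArith
import HarnessLib

/-!
# Verified arithmetic on stack programs: remainder and Euclid's algorithm

Trunk `CplxCore`, toolkit continuing `StackArith.lean` / `StackModArith.lean` (structured stack
programs `Com` on the arithmetic bank `AReg`, numerals least significant bit first, results kept
in normal form `norm`). Using only the conditional subtraction and normalisation of
`StackArith.lean`:

* `Com.remStep b` — one step of binary long division keeping the remainder,
  `x := (2x + b) mod y` (`runs_remStep`, `bitsToNat_remStepRes`);
* `Com.remOf m` — **the remainder** of the outer register `m` (dividend, most significant bit
  first, consumed) by `y`: from `x = 0`, `x := m mod y` (`runs_remOf`, `bitsToNat_remOfRes`,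
  `bitsToNat_remOfRes_nil`), in `|m| · (41|y| + 48) + 1` steps;
* `Com.swapXY`; `Com.euclidBody`, `Com.euclid fuel m d` — **Euclid's algorithm** `(x, y) :=
  (y, x mod y)` until `y = 0` (then the latch `d` is set), clocked by one round per bit of the
  outer register `fuel`; model `euclidStep`/`euclidIter` with `gcd_euclidStep` (CLRS Thm. 31.9,
  the GCD recursion theorem), `norm_euclidStep`, `length_euclidStep`, and the round bound
  `euclidIter_latch`: from normal operands the latch is set within `2 · size y + 1` rounds
  (every two rounds halve the second operand — the elementary form of Lamé's theorem,
  CLRS Thm. 31.11); `runs_euclidBody`, `runs_euclid`;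
* `Com.gcdXY fuel m d` — **`x := bin (gcd x y)`** with the clock built from two copies of `y`
  (`runs_gcdXY`, cost `(2|y| + 1) · (euclidCost (|x| + |y|) + 2) + 20|y| + 8`,
  `euclidCost L = L (41 L + 48) + 15 L + 12`).

Served: the `gcd`s of the classical part of Shor's algorithm (`ShorFactoring.lean`,
`Shor1997.splitStep`; programming fact `shorComp_isPolyTime` of `ShorClassicalOracle.lean`) and
any `FP`-membership proof needing division with remainder.

## References

* T. H. Cormen, C. E. Leiserson, R. L. Rivest, C. Stein, *Introduction to Algorithms*, MIT Press
  (3rd ed. 2009), §31.2: procedure EUCLID, Thm. 31.9 (GCD recursion theorem), Lemma 31.10 and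
  Thm. 31.11 (Lamé). Text checked in the held 2nd edition (`book:cormennd-introduction-
  algorithms`, pp. 656–658 of the file).
* D. E. Knuth, *The Art of Computer Programming*, Vol. 2, 3rd ed., Addison-Wesley 1998, §4.3.1
  (Algorithm D, long division; here radix 2, remainder only) and §4.5.2 (Euclid's algorithm).
  (Not held; the algorithms are the schoolbook ones and are fully proved here.)
* T. Nipkow, G. Klein, *Concrete Semantics with Isabelle/HOL*, Springer 2014, Ch. 7, for the
  verification style.
-/

namespace Literature.Computability.Complexity

open _root_.Computability AReg

namespace Com

/-! ### One bit of long division: `x := (2x + b) mod y` -/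

/-- `remStep b`: on the bank, `x := (2x + b) mod y` for `x < y` (push the low bit `b`,
conditionally subtract `y`, drop the comparison flag, normalise) — one step of binary long
division keeping only the remainder (Knuth's Algorithm D in radix 2, remainder only). [folklore] -/
def remStep (b : Bool) : Com AReg := push .x b ;; sub ;; clear .g ;; normalize

/-- Raw model of `remStep` (before normalisation). [folklore] -/
def remStepRaw (b : Bool) (acc n : List Bool) : List Bool :=
  bif subBorrow (b :: acc) n then b :: acc else subRes (b :: acc) n

/-- Model of `remStep`. [folklore] -/
def remStepRes (b : Bool) (acc n : List Bool) : List Bool := norm (remStepRaw b acc n)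

/-- Value of the raw model. [folklore] -/
theorem bitsToNat_remStepRaw (b : Bool) (acc n : List Bool) (h : bitsToNat acc < bitsToNat n) :
    bitsToNat (remStepRaw b acc n) = (2 * bitsToNat acc + b.toNat) % bitsToNat n := by
  unfold remStepRaw
  have h2 : bitsToNat (b :: acc) = 2 * bitsToNat acc + b.toNat := by simp; ring
  rw [subBorrow_iff, h2]
  by_cases hlt : 2 * bitsToNat acc + b.toNat < bitsToNat n
  · simp [hlt, Nat.mod_eq_of_lt hlt, h2]
  · have hle : bitsToNat n ≤ 2 * bitsToNat acc + b.toNat := Nat.le_of_not_lt hlt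
    have hb : b.toNat ≤ 1 := Bool.toNat_le b
    simp only [hlt, decide_false, cond_false]
    rw [bitsToNat_subRes _ _ (by rw [h2]; exact hle), h2, Nat.mod_eq_sub_mod hle,
      Nat.mod_eq_of_lt (by omega)]

/-- Length of the raw model. [folklore] -/
theorem length_remStepRaw (b : Bool) (acc n : List Bool) : (remStepRaw b acc n).length = acc.length + 1 := by
  unfold remStepRaw
  cases subBorrow (b :: acc) n <;> simp [length_subRes]

/-- **Value of `remStep`.** [folklore] -/
theorem bitsToNat_remStepRes (b : Bool) (acc n : List Bool) (h : bitsToNat acc < bitsToNat n) :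
    bitsToNat (remStepRes b acc n) = (2 * bitsToNat acc + b.toNat) % bitsToNat n := by
  rw [remStepRes, bitsToNat_norm, bitsToNat_remStepRaw b acc n h]

/-- The result of `remStep` is reduced. [folklore] -/
theorem bitsToNat_remStepRes_lt (b : Bool) (acc n : List Bool) (h : bitsToNat acc < bitsToNat n) :
    bitsToNat (remStepRes b acc n) < bitsToNat n := by
  rw [bitsToNat_remStepRes b acc n h]; exact Nat.mod_lt _ (by omega)

/-- The result of `remStep` is not longer than the modulus. [folklore] -/
theorem length_remStepRes_le (b : Bool) (acc n : List Bool) (h : bitsToNat acc < bitsToNat n) :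
    (remStepRes b acc n).length ≤ n.length :=
  length_norm_le_of_lt (by rw [bitsToNat_remStepRaw b acc n h]; exact Nat.mod_lt _ (by omega))

/-- **Simulation of `remStep`**, in `25|x| + 16|y| + 46` steps. [folklore] -/
theorem runs_remStep (b : Bool) (acc n z : List Bool) :
    Runs (remStep b) (file acc n z [] [] [] [] []) (file (remStepRes b acc n) n z [] [] [] [] [])
      (25 * acc.length + 16 * n.length + 46) := by
  have h1 : Runs (push .x b) (file acc n z [] [] [] [] []) (file (b :: acc) n z [] [] [] [] []) 1 :=
    Runs.push' (by simp)
  have h2 := runs_sub (b :: acc) n z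
  have h3 : Runs (clear .g) (file (remStepRaw b acc n) n z [] [] [] [] (flag !subBorrow (b :: acc) n))
      (file (remStepRaw b acc n) n z [] [] [] [] []) 3 :=
    (runs_clear AReg.g _).of_eq (by simp) (by cases subBorrow (b :: acc) n <;> simp)
  have h4 := runs_normalize (remStepRaw b acc n) n z [] [] []
  refine (h1.seq (h2.seq (h3.seq h4))).of_eq rfl ?_
  rw [length_remStepRaw, List.length_cons]; omega

/-! ### Remainder of an outer register (most significant bit first) -/

section Embedded

variable {κ : Type} [DecidableEq κ]

/-- `remOf m`: **binary long division, remainder only**: for the bits of the outer register `m`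
(the dividend, *most significant bit first*, consumed): `x := (2x + bit) mod y`; from `x = 0`
this leaves `x = m mod y`. [folklore] -/
def remOf (m : κ) : Com (κ ⊕ AReg) := loop (Sum.inl m) (bk (remStep true)) (bk (remStep false))

/-- Model of `remOf`. [folklore] -/
def remOfRes : List Bool → List Bool → List Bool → List Bool
  | [], acc, _ => acc
  | b :: bs, acc, n => remOfRes bs (remStepRes b acc n) n

/-- The model is reduced and short. [folklore] -/
theorem remOfRes_lt_and_length : ∀ (bs acc n : List Bool), bitsToNat acc < bitsToNat n →
    acc.length ≤ n.length →
      bitsToNat (remOfRes bs acc n) < bitsToNat n ∧ (remOfRes bs acc n).length ≤ n.length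
  | [], _, _, h, hl => ⟨h, hl⟩
  | b :: bs, acc, n, h, _ =>
    remOfRes_lt_and_length bs _ n (bitsToNat_remStepRes_lt b acc n h) (length_remStepRes_le b acc n h)

/-- **Value of `remOf`** (the dividend read most significant bit first). [folklore] -/
theorem bitsToNat_remOfRes : ∀ (bs acc n : List Bool), bitsToNat acc < bitsToNat n →
    bitsToNat (remOfRes bs acc n) = (bitsToNat acc * 2 ^ bs.length + bitsToNat bs.reverse) % bitsToNat n
  | [], acc, n, h => by simp [remOfRes, Nat.mod_eq_of_lt h]
  | b :: bs, acc, n, h => by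
    rw [remOfRes, bitsToNat_remOfRes bs _ n (bitsToNat_remStepRes_lt b acc n h),
      bitsToNat_remStepRes b acc n h, List.reverse_cons, bitsToNat_append, List.length_reverse,
      List.length_cons, bitsToNat_cons, bitsToNat_nil, pow_succ]
    simp only [mul_zero, add_zero]
    rw [Nat.add_mod, Nat.mod_mul_mod, ← Nat.add_mod]
    congr 1; ring

/-- **`remOf` from zero computes the remainder** `m mod y`. [folklore] -/
theorem bitsToNat_remOfRes_nil (bs n : List Bool) (hn : 0 < bitsToNat n) :
    bitsToNat (remOfRes bs [] n) = bitsToNat bs.reverse % bitsToNat n := by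
  rw [bitsToNat_remOfRes bs [] n (by simpa using hn)]; simp

/-- **Simulation of `remOf`**: with `T m = bs`, `x = acc < y = n`, `|acc| ≤ |n|`, the loop
empties `m` and leaves `remOfRes bs acc n` in `x`, in `|bs| · (41|n| + 48) + 1` steps.
[folklore] -/
theorem runs_remOf (m : κ) : ∀ (bs : List Bool) (T : Regs κ) (acc n zz : List Bool),
    T m = bs → bitsToNat acc < bitsToNat n → acc.length ≤ n.length →
      Runs (remOf m) (Sum.elim T (file acc n zz [] [] [] [] []))
        (Sum.elim (Function.update T m []) (file (remOfRes bs acc n) n zz [] [] [] [] []))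
        (bs.length * (41 * n.length + 48) + 1)
  | [], T, acc, n, zz, hT, _, _ => by
    refine (Runs.loop_nil _ _ (by simp [hT])).of_eq ?_ (by simp)
    rw [remOfRes, ← hT, Function.update_eq_self]
  | b :: bs, T, acc, n, zz, hT, h, hl => by
    have hk : (Sum.elim T (file acc n zz [] [] [] [] []) : Regs (κ ⊕ AReg)) (Sum.inl m) = b :: bs := by
      simp [hT]
    have hbody : ∀ b' : Bool, Runs (bk (remStep b') : Com (κ ⊕ AReg))
        (Function.update (Sum.elim T (file acc n zz [] [] [] [] [])) (Sum.inl m) bs)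
        (Sum.elim (Function.update T m bs) (file (remStepRes b' acc n) n zz [] [] [] [] []))
        (41 * n.length + 46) := fun b' => by
      rw [Sum.update_elim_inl]
      exact ((runs_remStep b' acc n zz).inr _).of_eq rfl (by nlinarith [hl])
    have hrest := runs_remOf m bs (Function.update T m bs) (remStepRes b acc n) n zz
      (by simp) (bitsToNat_remStepRes_lt b acc n h) (length_remStepRes_le b acc n h)
    rw [Function.update_idem] at hrest
    cases b
    · exact (Runs.loop_false hk (hbody false) hrest).of_eq rfl (by simp; ring_nf; omega)
    · exact (Runs.loop_true hk (hbody true) hrest).of_eq rfl (by simp; ring_nf; omega)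

end Embedded

/-! ### Exchanging the two operands -/

/-- `swapXY`: exchange `x` and `y` (through the empty scratch `s t`). [folklore] -/
def swapXY : Com AReg := pour .x .s ;; pour .y .t ;; pour .s .y ;; pour .t .x

/-- **Simulation of `swapXY`**, in `6(|x| + |y|) + 4` steps. [folklore] -/
theorem runs_swapXY (x y z u f g : List Bool) :
    Runs swapXY (file x y z [] [] u f g) (file y x z [] [] u f g) (6 * (x.length + y.length) + 4) := by
  have h1 : Runs (pour .x .s) (file x y z [] [] u f g) (file [] y z x.reverse [] u f g) (3 * x.length + 1) :=
    (runs_pour (a := AReg.x) (b := AReg.s) (by decide) _).of_eq (by simp) (by simp)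
  have h2 : Runs (pour .y .t) (file [] y z x.reverse [] u f g) (file [] [] z x.reverse y.reverse u f g)
      (3 * y.length + 1) :=
    (runs_pour (a := AReg.y) (b := AReg.t) (by decide) _).of_eq (by simp) (by simp)
  have h3 : Runs (pour .s .y) (file [] [] z x.reverse y.reverse u f g) (file [] x z [] y.reverse u f g)
      (3 * x.length + 1) :=
    (runs_pour (a := AReg.s) (b := AReg.y) (by decide) _).of_eq (by simp) (by simp)
  have h4 : Runs (pour .t .x) (file [] x z [] y.reverse u f g) (file y x z [] [] u f g)
      (3 * y.length + 1) :=
    (runs_pour (a := AReg.t) (b := AReg.x) (by decide) _).of_eq (by simp) (by simp)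
  exact (h1.seq (h2.seq (h3.seq h4))).of_eq rfl (by omega)

/-! ### Euclid's algorithm -/

section Euclid

variable {κ : Type} [DecidableEq κ]

/-- One round of Euclid's algorithm on the bank operands `(x, y)`, unless the latch `d` is set:
if `y = 0` (the empty normal numeral) set the latch; otherwise `(x, y) := (y, x mod y)` — pour
`x` (most significant bit first) into the outer register `m`, take the remainder by `y`
(`remOf`), exchange. [cite: CLRS2009, §31.2 (EUCLID)] -/
def euclidBody (m d : κ) : Com (κ ⊕ AReg) :=
  pop (Sum.inl d) (push (Sum.inl d) true)
    (pop (Sum.inr .y) (push (Sum.inr .y) true ;; (pour (Sum.inr .x) (Sum.inl m) ;; (remOf m ;; bk swapXY)))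
      (push (Sum.inr .y) false ;; (pour (Sum.inr .x) (Sum.inl m) ;; (remOf m ;; bk swapXY)))
      (push (Sum.inl d) true))
    (pop (Sum.inr .y) (push (Sum.inr .y) true ;; (pour (Sum.inr .x) (Sum.inl m) ;; (remOf m ;; bk swapXY)))
      (push (Sum.inr .y) false ;; (pour (Sum.inr .x) (Sum.inl m) ;; (remOf m ;; bk swapXY)))
      (push (Sum.inl d) true))

/-- Euclid's algorithm, clocked by the outer register `fuel` (one round per bit). [cite: CLRS2009, §31.2 (EUCLID)] -/
def euclid (fuel m d : κ) : Com (κ ⊕ AReg) := loop (Sum.inl fuel) (euclidBody m d) (euclidBody m d)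

/-- Model of one round on `(x, y, latch)`. [folklore] -/
def euclidStep : List Bool × List Bool × Bool → List Bool × List Bool × Bool
  | (xs, ys, true) => (xs, ys, true)
  | (xs, [], false) => (xs, [], true)
  | (xs, b :: ys, false) => (b :: ys, remOfRes xs.reverse [] (b :: ys), false)

/-- Model of `k` rounds. [folklore] -/
def euclidIter (k : ℕ) (s : List Bool × List Bool × Bool) : List Bool × List Bool × Bool := euclidStep^[k] s

/-- A latched state is fixed. [folklore] -/
theorem euclidStep_latched (xs ys : List Bool) : euclidStep (xs, ys, true) = (xs, ys, true) := rfl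

/-- Iterating from a latched state. [folklore] -/
theorem euclidIter_latched (k : ℕ) (xs ys : List Bool) : euclidIter k (xs, ys, true) = (xs, ys, true) := by
  induction k with
  | zero => rfl
  | succ k ih => rw [euclidIter, Function.iterate_succ_apply, euclidStep_latched]; exact ih

/-- Unrolling the iteration. [folklore] -/
theorem euclidIter_succ (k : ℕ) (st : List Bool × List Bool × Bool) :
    euclidIter (k + 1) st = euclidIter k (euclidStep st) := by
  rw [euclidIter, Function.iterate_succ_apply]; rfl

/-- Normal numerals (fixed by `norm`) that are nonempty have a positive value. [folklore] -/
theorem bitsToNat_pos_of_norm_eq {l : List Bool} (h : norm l = l) (hl : l ≠ []) : 0 < bitsToNat l := by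
  by_contra h0
  have : bitsToNat l = 0 := by omega
  rw [← norm_eq_nil_iff] at this
  exact hl (by rw [← h, this])

/-- `norm` is idempotent. [folklore] -/
theorem norm_norm (l : List Bool) : norm (norm l) = norm l := by
  rw [norm_eq_encodeNat, bitsToNat_norm, ← norm_eq_encodeNat]

/-- **One round preserves the `gcd` of the operand values** (on normal operands).
[cite: CLRS2009, §31.2 (Thm. 31.9, GCD recursion theorem)] -/
theorem gcd_euclidStep (xs ys : List Bool) (d : Bool) (hy : norm ys = ys) :
    Nat.gcd (bitsToNat (euclidStep (xs, ys, d)).1) (bitsToNat (euclidStep (xs, ys, d)).2.1) =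
      Nat.gcd (bitsToNat xs) (bitsToNat ys) := by
  cases d
  · cases ys with
    | nil => rfl
    | cons b ys =>
      have hpos := bitsToNat_pos_of_norm_eq hy (List.cons_ne_nil _ _)
      simp only [euclidStep]
      rw [bitsToNat_remOfRes_nil _ _ hpos, List.reverse_reverse, Nat.gcd_comm (bitsToNat xs),
        Nat.gcd_rec (bitsToNat (b :: ys)) (bitsToNat xs), Nat.gcd_comm]
  · rfl

/-- **One round keeps the operands normal.** [folklore] -/
theorem norm_euclidStep (xs ys : List Bool) (d : Bool) (hx : norm xs = xs) (hy : norm ys = ys) :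
    norm (euclidStep (xs, ys, d)).1 = (euclidStep (xs, ys, d)).1 ∧
      norm (euclidStep (xs, ys, d)).2.1 = (euclidStep (xs, ys, d)).2.1 := by
  cases d
  · cases ys with
    | nil => exact ⟨hx, hy⟩
    | cons b ys =>
      refine ⟨hy, ?_⟩
      simp only [euclidStep]
      -- `remOfRes` over a nonempty dividend ends with `norm`; over the empty one it is `[]`
      cases hxs : xs.reverse with
      | nil => rfl
      | cons c cs =>
        simp only [remOfRes]
        suffices h : ∀ (bs acc : List Bool), norm acc = acc → norm (remOfRes bs acc (b :: ys)) = remOfRes bs acc (b :: ys) from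
          h cs _ (norm_norm _)
        intro bs
        induction bs with
        | nil => intro acc h; exact h
        | cons c' bs ih => intro acc _; exact ih _ (norm_norm _)
  · exact ⟨hx, hy⟩

/-- **One round keeps the operands short**: values never exceed the larger initial operand, so
normal operands of value `≤ V` have length `≤ size V`. Stated as: lengths stay below a common
bound `L` dominating both operands and the modulus length. [folklore] -/
theorem length_euclidStep (xs ys : List Bool) (d : Bool) (L : ℕ) (hx : xs.length ≤ L) (hy : ys.length ≤ L)
    (hyn : norm ys = ys) :
    (euclidStep (xs, ys, d)).1.length ≤ L ∧ (euclidStep (xs, ys, d)).2.1.length ≤ L := by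
  cases d
  · cases ys with
    | nil => exact ⟨hx, hy⟩
    | cons b ys =>
      refine ⟨hy, ?_⟩
      simp only [euclidStep]
      have hpos := bitsToNat_pos_of_norm_eq hyn (List.cons_ne_nil _ _)
      exact ((remOfRes_lt_and_length _ _ _ (by simpa using hpos) (by simp)).2).trans hy
  · exact ⟨hx, hy⟩

/-- **Euclid's algorithm latches within `2 · size y + 1` rounds** (every two rounds halve the
second operand: `y mod (x mod y) < y / 2`). [cite: CLRS2009, §31.2 (Thm. 31.11, Lamé; here the elementary bound 2·size y + 1 by halving)] -/
theorem euclidIter_latch : ∀ (Y : ℕ) (xs ys : List Bool), bitsToNat ys = Y → norm xs = xs → norm ys = ys →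
    ∀ k, 2 * Y.size + 1 ≤ k → (euclidIter k (xs, ys, false)).2.2 = true := by
  intro Y
  induction Y using Nat.strong_induction_on with
  | _ Y ih =>
    intro xs ys hY hx hy k hk
    cases ys with
    | nil =>
      obtain ⟨k, rfl⟩ : ∃ k', k = k' + 1 := ⟨k - 1, by omega⟩
      rw [euclidIter_succ]; simp only [euclidStep]; rw [euclidIter_latched]
    | cons b ys =>
      have hYpos : 0 < Y := by rw [← hY]; exact bitsToNat_pos_of_norm_eq hy (List.cons_ne_nil _ _)
      have hsz : 1 ≤ Y.size := Nat.size_pos.2 hYpos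
      obtain ⟨k, rfl⟩ : ∃ k', k = k' + 2 := ⟨k - 2, by omega⟩
      rw [euclidIter_succ]
      simp only [euclidStep]
      set r1 := remOfRes xs.reverse [] (b :: ys) with hr1
      have hr1v : bitsToNat r1 = bitsToNat xs % Y := by
        rw [hr1, bitsToNat_remOfRes_nil _ _ (by rw [hY]; exact hYpos), List.reverse_reverse, hY]
      have hr1n : norm r1 = r1 := (norm_euclidStep xs (b :: ys) false hx hy).2
      rw [euclidIter_succ]
      by_cases hr0 : r1 = []
      · rw [hr0]; simp only [euclidStep]; rw [euclidIter_latched]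
      · obtain ⟨c, cs, hr⟩ := List.exists_cons_of_ne_nil hr0
        rw [hr]; simp only [euclidStep]; rw [← hr]
        set r2 := remOfRes (b :: ys).reverse [] r1 with hr2
        have hR1pos : 0 < bitsToNat r1 := bitsToNat_pos_of_norm_eq hr1n hr0
        have hR1lt : bitsToNat r1 < Y := by rw [hr1v]; exact Nat.mod_lt _ hYpos
        have hr2v : bitsToNat r2 = Y % bitsToNat r1 := by
          rw [hr2, bitsToNat_remOfRes_nil _ _ hR1pos, List.reverse_reverse, hY]
        have hr2n : norm r2 = r2 := by
          have := (norm_euclidStep (b :: ys) r1 false hy hr1n).2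
          rw [hr] at this; simp only [euclidStep] at this; rw [← hr] at this
          exact this
        -- the halving
        have hhalf : 2 * bitsToNat r2 < Y := by
          rw [hr2v]
          by_cases h2 : 2 * bitsToNat r1 ≤ Y
          · have := Nat.mod_lt Y hR1pos; omega
          · have hdiv : Y / bitsToNat r1 = 1 := by
              apply Nat.div_eq_of_lt_le <;> omega
            have := Nat.mod_add_div Y (bitsToNat r1)
            rw [hdiv, mul_one] at this
            omega
        have hsize : (bitsToNat r2).size ≤ Y.size - 1 := by
          apply Nat.size_le.2
          have hYlt := Nat.lt_size_self Y
          have e : Y.size = Y.size - 1 + 1 := by omega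
          rw [e, pow_succ] at hYlt
          omega
        exact ih (bitsToNat r2) (by omega) r1 r2 rfl hr1n hr2n k (by omega)

/-- Invariants along the iteration: normal operands of bounded length. [folklore] -/
theorem euclidIter_inv (L : ℕ) : ∀ (k : ℕ) (xs ys : List Bool) (dn : Bool), norm xs = xs → norm ys = ys →
    xs.length ≤ L → ys.length ≤ L →
      norm (euclidIter k (xs, ys, dn)).1 = (euclidIter k (xs, ys, dn)).1 ∧
      norm (euclidIter k (xs, ys, dn)).2.1 = (euclidIter k (xs, ys, dn)).2.1 ∧
      (euclidIter k (xs, ys, dn)).1.length ≤ L ∧ (euclidIter k (xs, ys, dn)).2.1.length ≤ L ∧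
      Nat.gcd (bitsToNat (euclidIter k (xs, ys, dn)).1) (bitsToNat (euclidIter k (xs, ys, dn)).2.1) =
        Nat.gcd (bitsToNat xs) (bitsToNat ys)
  | 0, xs, ys, dn, hx, hy, hxl, hyl => ⟨hx, hy, hxl, hyl, rfl⟩
  | k + 1, xs, ys, dn, hx, hy, hxl, hyl => by
    rw [euclidIter_succ]
    have hn := norm_euclidStep xs ys dn hx hy
    have hl := length_euclidStep xs ys dn L hxl hyl hy
    have hg := gcd_euclidStep xs ys dn hy
    rcases hst : euclidStep (xs, ys, dn) with ⟨x', y', d'⟩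
    rw [hst] at hn hl hg
    obtain ⟨h1, h2, h3, h4, h5⟩ := euclidIter_inv L k x' y' d' hn.1 hn.2 hl.1 hl.2
    exact ⟨h1, h2, h3, h4, h5.trans hg⟩

/-- Cost of one round of Euclid's algorithm with operands of length `≤ L`. [folklore] -/
def euclidCost (L : ℕ) : ℕ := L * (41 * L + 48) + 15 * L + 12

/-- **Simulation of one round** (see `euclidBody`). [folklore] -/
theorem runs_euclidBody {m d : κ} (T : Regs κ) (hm : T m = []) (xs ys zz : List Bool) (dn : Bool)
    (hd : T d = flag dn) (hyn : norm ys = ys) (L : ℕ) (hx : xs.length ≤ L) (hy : ys.length ≤ L) :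
    Runs (euclidBody m d) (Sum.elim T (file xs ys zz [] [] [] [] []))
      (Sum.elim (Function.update T d (flag (euclidStep (xs, ys, dn)).2.2))
        (file (euclidStep (xs, ys, dn)).1 (euclidStep (xs, ys, dn)).2.1 zz [] [] [] [] []))
      (euclidCost L) := by
  have hC : 3 ≤ euclidCost L := by unfold euclidCost; omega
  cases dn
  · -- not latched
    have hk : (Sum.elim T (file xs ys zz [] [] [] [] []) : Regs (κ ⊕ AReg)) (Sum.inl d) = [] := by simp [hd]
    cases ys with
    | nil =>
      -- `y = 0`: latch
      simp only [euclidStep]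
      have hy0 : (Sum.elim T (file xs [] zz [] [] [] [] []) : Regs (κ ⊕ AReg)) (Sum.inr AReg.y) = [] := rfl
      refine (Runs.pop_nil _ _ hk (Runs.pop_nil _ _ hy0 (Runs.push' ?_))).of_eq rfl (by unfold euclidCost; omega)
      simp [-Sum.elim_update_left, -Sum.elim_update_right, hd]
    | cons b ys =>
      simp only [euclidStep]
      have hpos : 0 < bitsToNat (b :: ys) := bitsToNat_pos_of_norm_eq hyn (List.cons_ne_nil _ _)
      have hyb : (Sum.elim T (file xs (b :: ys) zz [] [] [] [] []) : Regs (κ ⊕ AReg)) (Sum.inr AReg.y) = b :: ys := rfl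
      -- the division branch, after restoring the peeked bit
      have hrestore : Runs (push (Sum.inr AReg.y) b : Com (κ ⊕ AReg))
          (Function.update (Sum.elim T (file xs (b :: ys) zz [] [] [] [] [])) (Sum.inr AReg.y) ys)
          (Sum.elim T (file xs (b :: ys) zz [] [] [] [] [])) 1 :=
        Runs.push' (by simp)
      have h1 : Runs (pour (Sum.inr AReg.x) (Sum.inl m) : Com (κ ⊕ AReg)) (Sum.elim T (file xs (b :: ys) zz [] [] [] [] []))
          (Sum.elim (Function.update T m xs.reverse) (file [] (b :: ys) zz [] [] [] [] [])) (3 * xs.length + 1) :=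
        (runs_pour (by simp) _).of_eq (by simp [-Sum.elim_update_left, -Sum.elim_update_right, hm]) (by simp)
      have h2 := runs_remOf m xs.reverse (Function.update T m xs.reverse) [] (b :: ys) zz (by simp)
        (by simpa using hpos) (by simp)
      have hTm : Function.update T m ([] : List Bool) = T := Function.update_eq_self_iff.2 hm.symm
      rw [Function.update_idem, hTm, List.length_reverse] at h2
      set r := remOfRes xs.reverse [] (b :: ys) with hr
      have hrl : r.length ≤ (b :: ys).length := (remOfRes_lt_and_length _ _ _ (by simpa using hpos) (by simp)).2
      have h3 : Runs (bk swapXY : Com (κ ⊕ AReg)) (Sum.elim T (file r (b :: ys) zz [] [] [] [] []))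
          (Sum.elim T (file (b :: ys) r zz [] [] [] [] [])) (6 * (r.length + (b :: ys).length) + 4) :=
        (runs_swapXY r (b :: ys) zz [] [] []).inr T
      have hbranch := hrestore.seq (h1.seq (h2.seq h3))
      have hfin : Sum.elim (Function.update T d (flag false)) (file (b :: ys) r zz [] [] [] [] []) =
          Sum.elim T (file (b :: ys) r zz [] [] [] [] []) := by
        rw [Function.update_eq_self_iff.2 hd.symm]
      rw [hfin]
      have hcost : 1 + (3 * xs.length + 1 + (xs.length * (41 * (b :: ys).length + 48) + 1 +
          (6 * (r.length + (b :: ys).length) + 4))) + 2 + 2 ≤ euclidCost L := by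
        unfold euclidCost
        have hp := Nat.mul_le_mul hx (show 41 * (b :: ys).length + 48 ≤ 41 * L + 48 by omega)
        generalize xs.length * (41 * (b :: ys).length + 48) = P at hp ⊢
        generalize L * (41 * L + 48) = Q at hp ⊢
        simp only [List.length_cons] at hrl hy ⊢
        omega
      cases b
      · exact (Runs.pop_nil _ _ hk (Runs.pop_false _ _ hyb hbranch)).of_eq rfl hcost
      · exact (Runs.pop_nil _ _ hk (Runs.pop_true _ _ hyb hbranch)).of_eq rfl hcost
  · -- latched: restore the flag bit
    simp only [euclidStep]
    have hk : (Sum.elim T (file xs ys zz [] [] [] [] []) : Regs (κ ⊕ AReg)) (Sum.inl d) = true :: [] := by simp [hd]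
    refine (Runs.pop_true _ _ hk (Runs.push' ?_)).of_eq rfl (by omega)
    simp [-Sum.elim_update_left, -Sum.elim_update_right]

/-- **Simulation of the clocked Euclid loop**: one round per bit of `fuel`, following the model
`euclidIter`. [folklore] -/
theorem runs_euclid {fuel m d : κ} (hmd : m ≠ d) (hfm : fuel ≠ m) (hfd : fuel ≠ d) (L : ℕ) :
    ∀ (ws : List Bool) (T : Regs κ) (xs ys zz : List Bool) (dn : Bool), T fuel = ws → T m = [] →
      T d = flag dn → norm xs = xs → norm ys = ys → xs.length ≤ L → ys.length ≤ L →
      Runs (euclid fuel m d) (Sum.elim T (file xs ys zz [] [] [] [] []))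
        (Sum.elim (Function.update (Function.update T fuel []) d (flag (euclidIter ws.length (xs, ys, dn)).2.2))
          (file (euclidIter ws.length (xs, ys, dn)).1 (euclidIter ws.length (xs, ys, dn)).2.1 zz [] [] [] [] []))
        (ws.length * (euclidCost L + 2) + 1)
  | [], T, xs, ys, zz, dn, hT, _, hd, _, _, _, _ => by
    refine (Runs.loop_nil _ _ (by simp [hT])).of_eq ?_ (by simp)
    simp only [List.length_nil, euclidIter, Function.iterate_zero, id_eq]
    have e1 : Function.update T fuel ([] : List Bool) = T := Function.update_eq_self_iff.2 hT.symm
    rw [e1]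
    have e2 : Function.update T d (flag dn) = T := Function.update_eq_self_iff.2 hd.symm
    rw [e2]
  | w :: ws, T, xs, ys, zz, dn, hT, hm, hd, hx, hy, hxl, hyl => by
    have hk : (Sum.elim T (file xs ys zz [] [] [] [] []) : Regs (κ ⊕ AReg)) (Sum.inl fuel) = w :: ws := by simp [hT]
    have hbody := runs_euclidBody (m := m) (d := d) (Function.update T fuel ws) (by simp [hfm.symm, hm]) xs ys zz dn
      (by simp [hfd.symm, hd]) hy L hxl hyl
    rw [← Sum.update_elim_inl] at hbody
    have hn := norm_euclidStep xs ys dn hx hy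
    have hl := length_euclidStep xs ys dn L hxl hyl hy
    rcases hst : euclidStep (xs, ys, dn) with ⟨x', y', d'⟩
    rw [hst] at hn hl hbody
    have hrest := runs_euclid hmd hfm hfd L ws (Function.update (Function.update T fuel ws) d (flag d')) x' y' zz d'
      (by simp [hfd]) (by simp [hmd, hfm.symm, hm]) (by simp) hn.1 hn.2 hl.1 hl.2
    rw [List.length_cons, euclidIter_succ, hst]
    have hfin : Function.update (Function.update (Function.update (Function.update T fuel ws) d (flag d')) fuel []) d
          (flag (euclidIter ws.length (x', y', d')).2.2) =
        Function.update (Function.update T fuel []) d (flag (euclidIter ws.length (x', y', d')).2.2) := by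
      rw [Function.update_comm hfd, Function.update_idem, Function.update_comm hfd.symm, Function.update_idem,
        Function.update_comm hfd]
    rw [hfin] at hrest
    cases w
    · exact (Runs.loop_false hk hbody hrest).of_eq rfl (by ring_nf; omega)
    · exact (Runs.loop_true hk hbody hrest).of_eq rfl (by ring_nf; omega)

/-- Once latched, the second operand is (and stays) empty. [folklore] -/
theorem euclidIter_latched_nil : ∀ (k : ℕ) (st : List Bool × List Bool × Bool),
    (st.2.2 = true → st.2.1 = []) → (euclidIter k st).2.2 = true → (euclidIter k st).2.1 = []
  | 0, st, h, hl => h hl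
  | k + 1, st, h, hl => by
    rw [euclidIter_succ] at hl ⊢
    refine euclidIter_latched_nil k (euclidStep st) ?_ hl
    obtain ⟨xs, ys, d⟩ := st
    cases d
    · cases ys with
      | nil => intro; rfl
      | cons b ys => simp [euclidStep]
    · intro; exact h rfl

/-- `gcdXY fuel m d`: **the greatest common divisor** of the bank operands: clock
`2|y| + 1` rounds into the outer register `fuel` (two copies of `y` and a bit) and run the
clocked Euclid loop; leaves `bin (gcd x y)` in `x`, `y` empty and the latch `d` set.
[cite: CLRS2009, §31.2 (EUCLID; Lemma 31.10)] -/
def gcdXY (fuel m d : κ) : Com (κ ⊕ AReg) :=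
  copy (Sum.inr .y) (Sum.inl fuel) (Sum.inr .s) (Sum.inr .t) ;;
  (copy (Sum.inr .y) (Sum.inl fuel) (Sum.inr .s) (Sum.inr .t) ;;
  (push (Sum.inl fuel) true ;; euclid fuel m d))

/-- **Simulation of `gcdXY`**: on normal operands `x = a`, `y = b` (outer `fuel`, `m`, `d`
empty) it leaves `x = encodeNat (gcd a b)`, `y = []`, `d = [true]`, within
`(2|b| + 1) · (euclidCost (|a| + |b|) + 2) + 20|b| + 8` steps. [cite: CLRS2009, §31.2 (Thm. 31.11: EUCLID runs O(lg b) rounds)] -/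
theorem runs_gcdXY {fuel m d : κ} (hmd : m ≠ d) (hfm : fuel ≠ m) (hfd : fuel ≠ d) (T : Regs κ)
    (hf : T fuel = []) (hm : T m = []) (hd : T d = []) (a b zz : List Bool) (ha : norm a = a) (hb : norm b = b) :
    Runs (gcdXY fuel m d) (Sum.elim T (file a b zz [] [] [] [] []))
      (Sum.elim (Function.update T d [true])
        (file (encodeNat (Nat.gcd (bitsToNat a) (bitsToNat b))) [] zz [] [] [] [] []))
      ((2 * b.length + 1) * (euclidCost (a.length + b.length) + 2) + 20 * b.length + 8) := by
  -- the clock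
  have h1 : Runs (copy (Sum.inr AReg.y) (Sum.inl fuel) (Sum.inr AReg.s) (Sum.inr AReg.t) : Com (κ ⊕ AReg))
      (Sum.elim T (file a b zz [] [] [] [] [])) (Sum.elim (Function.update T fuel b) (file a b zz [] [] [] [] []))
      (10 * b.length + 3) :=
    (runs_copy (by simp) (by simp) (by simp) (by simp) (by simp) (by simp) _ (by simp) (by simp)).of_eq
      (by simp [-Sum.elim_update_left, -Sum.elim_update_right, hf]) (by simp)
  have h2 : Runs (copy (Sum.inr AReg.y) (Sum.inl fuel) (Sum.inr AReg.s) (Sum.inr AReg.t) : Com (κ ⊕ AReg))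
      (Sum.elim (Function.update T fuel b) (file a b zz [] [] [] [] []))
      (Sum.elim (Function.update T fuel (b ++ b)) (file a b zz [] [] [] [] [])) (10 * b.length + 3) :=
    (runs_copy (by simp) (by simp) (by simp) (by simp) (by simp) (by simp) _ (by simp) (by simp)).of_eq
      (by simp [-Sum.elim_update_left, -Sum.elim_update_right]) (by simp)
  have h3 : Runs (push (Sum.inl fuel) true : Com (κ ⊕ AReg))
      (Sum.elim (Function.update T fuel (b ++ b)) (file a b zz [] [] [] [] []))
      (Sum.elim (Function.update T fuel (true :: (b ++ b))) (file a b zz [] [] [] [] [])) 1 :=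
    Runs.push' (by simp [-Sum.elim_update_left, -Sum.elim_update_right])
  -- the loop
  set L := a.length + b.length with hL
  have h4 := runs_euclid hmd hfm hfd L (true :: (b ++ b)) (Function.update T fuel (true :: (b ++ b))) a b zz false
    (by simp) (by simp [hfm.symm, hm]) (by simp [hfd.symm, hd]) ha hb (by omega) (by omega)
  rw [Function.update_idem] at h4
  set k := (true :: (b ++ b)).length with hk
  have hkv : k = 2 * b.length + 1 := by simp [hk]; ring
  -- the model after `k` rounds: latched, `y = 0`, `x = bin (gcd a b)`
  have hlatch : (euclidIter k (a, b, false)).2.2 = true := by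
    refine euclidIter_latch (bitsToNat b) a b rfl ha hb k ?_
    have : (bitsToNat b).size ≤ b.length := Nat.size_le.2 (bitsToNat_lt b)
    omega
  have hnil : (euclidIter k (a, b, false)).2.1 = [] :=
    euclidIter_latched_nil k (a, b, false) (fun h => by simp at h) hlatch
  obtain ⟨hxn, -, -, -, hg⟩ := euclidIter_inv L k a b false ha hb (by omega) (by omega)
  rw [hnil, bitsToNat_nil, Nat.gcd_zero_right] at hg
  have hx : (euclidIter k (a, b, false)).1 = encodeNat (Nat.gcd (bitsToNat a) (bitsToNat b)) := by
    rw [← hg, ← norm_eq_encodeNat, hxn]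
  rw [hlatch, hnil, hx, flag_true] at h4
  have hTf : Function.update T fuel ([] : List Bool) = T := Function.update_eq_self_iff.2 hf.symm
  rw [hTf] at h4
  refine (h1.seq (h2.seq (h3.seq h4))).of_eq rfl ?_
  rw [hkv]
  omega

end Euclid

end Com
end Literature.Computability.Complexity
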